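import Summits.CriticalPhenomena.PercolationContinuityZ3.Theorems.PercNearOneGluingNoHeavyLowerTailKnQuestion8CoefficientwiseCoreClassKernelMixDoubleRoot
import HarnessLib

/-!
# THEOREM DR-Θ: the double-root one-sided form for internal degree ≤ 2 (cycles, bundles) via the double-root `R_A`

Support file (`--supports stmt-CriticalPhenomena-4575`, closed), prover `prim-cplus-coupling` (gen 37).  No definitions, no notations, no named facts,
no sorries; standard axioms.  Memo `prim-cplus-coupling/A5-COUPLING-gen37.md` §1.  Companion of `…CoreClassKernelMixDoubleRoot` (THEOREM DR-C).

Setting: edge set `E`, roots `u, v`, observer `b`; `P = C_u ω ∪ C_v ω`, `Q = C_b(E∖ω)`, `S = P ∪ C_b ω`.  THE DOUBLE-ROOT `R_A`: `ψ ω = ω ∆ F(ω)`,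
`F(ω)` = the edges of `E` meeting no vertex of `P` (recolour everything away from `P`, keep everything at `P`).
* `Coefficientwise.openCluster_symmDiff_off_eq` — flipping edges away from a set `P ⊇ C_x ω` keeps `C_x`; hence `ψ` keeps `C_u, C_v`, is an involution,
  and is PROPER (`b ∉ C_u(ψω) ∪ C_v(ψω)`).
* `Coefficientwise.doubleRoot_pocketFree_of_deg_le_two` — if no vertex other than `u, v, b` lies on three edges, then on the wall part
  `{b ∉ P, u, v ∉ Q}` every vertex of `Q ∖ P` is joined to `b` by a blue path avoiding `P` (so it turns red under `ψ`): `Q ⊆ P ∪ C_b({blue edges off P})`.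
* `Coefficientwise.coreClass_doubleRoot_of_deg_le_two` — **THEOREM DR-Θ**: for such `E`, the double-root form
  `Σ_ω h(S)k(S) + Σ_{b ∉ P} (hᵃ(P) − hᵇ(Q))(kᵃ(P) − kᵇ(Q)) ≥ 0` holds at all monotone levels — the `RR` class of the hat 2-sum
  `KB-MIX-FULL(a~{u,v} + E; a, b)` for every cycle through `u, b, v` and every bundle (gen 36 memo §5.1; gen 37 memo §1).
[cite: KozmaNitzan2024, Questions 8–9 (§5.5 p. 36) (context: the Question-8 pocket covariance programme)]
-/

namespace Summit.CriticalPhenomena.PercolationContinuityZ3.Theorems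

open Finset Literature.Probability.Percolation
open scoped symmDiff

namespace Coefficientwise

variable {ι V : Type*}

open Classical in
/-- **Flipping the edges away from a set `P` keeps every red cluster inside `P`.**  If `C_x(ω) ⊆ P` and every edge of `F` avoids `P`, then
`C_x(ω ∆ F) = C_x(ω)`. [cite: KozmaNitzan2024, §5.5 (context only; folklore)] -/
theorem openCluster_symmDiff_off_eq (ends : ι → Sym2 V) (ω F : Finset ι) (x : V) (P : Set V)
    (hP : openCluster (ends '' (↑ω : Set ι)) x ⊆ P) (hF : ∀ i ∈ F, ∀ y, y ∈ ends i → y ∉ P) :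
    openCluster (ends '' (↑(ω ∆ F) : Set ι)) x = openCluster (ends '' (↑ω : Set ι)) x := by
  apply Set.Subset.antisymm
  · -- `C_x(ω)` is closed under the edges of `ω ∆ F`
    refine openCluster_subset_of_closed ends (ω ∆ F) x (S := openCluster (ends '' (↑ω : Set ι)) x) (mem_openCluster_self _ _) ?_
    intro i hi y z he hy
    have hiF : i ∉ F := fun hiF => hF i hiF y (by rw [he]; exact Sym2.mem_mk_left y z) (hP hy)
    have hiω : i ∈ ω := by
      rw [Finset.mem_symmDiff] at hi
      rcases hi with ⟨h, _⟩ | ⟨h, _⟩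
      · exact h
      · exact absurd h hiF
    exact mem_openCluster_of_edge ends hiω he hy
  · have hsub : ω \ F ⊆ ω ∆ F := by
      intro i hi
      rw [Finset.mem_sdiff] at hi
      rw [Finset.mem_symmDiff]
      exact Or.inl ⟨hi.1, hi.2⟩
    refine le_trans ?_ (openCluster_image_mono ends hsub x)
    refine openCluster_subset_of_closed ends ω x (S := openCluster (ends '' (↑(ω \ F) : Set ι)) x) (mem_openCluster_self _ _) ?_
    intro i hi y z he hy
    have hyP : y ∈ P := hP (openCluster_image_mono ends Finset.sdiff_subset x hy)
    have hiF : i ∉ F := fun hiF => hF i hiF y (by rw [he]; exact Sym2.mem_mk_left y z) hyP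
    exact mem_openCluster_of_edge ends (Finset.mem_sdiff.mpr ⟨hi, hiF⟩) he hy

open Classical in
/-- **Double-root pocket-freeness from internal degree `≤ 2`.**  If no vertex other than `u, v, b` lies on three distinct edges of `E`, then for every
`ω ⊆ E` with `b ∉ C_u ω ∪ C_v ω` and `u, v ∉ C_b(E∖ω)`, every vertex of the blue cluster of `b` outside `P = C_u ω ∪ C_v ω` is joined to `b` by a blue
path avoiding `P`:  `C_b(E∖ω) ⊆ P ∪ C_b({i ∈ E∖ω : i avoids P})`. [cite: KozmaNitzan2024, §5.5 (context only)] -/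
theorem doubleRoot_pocketFree_of_deg_le_two (ends : ι → Sym2 V) (E : Finset ι) (u v b : V)
    (hdeg : ∀ x, x ≠ u → x ≠ v → x ≠ b → ∀ i j l, i ∈ E → j ∈ E → l ∈ E → x ∈ ends i → x ∈ ends j → x ∈ ends l → i = j ∨ i = l ∨ j = l)
    (ω : Finset ι) (hω : ω ⊆ E) (hbu : b ∉ openCluster (ends '' (↑ω : Set ι)) u) (hbv : b ∉ openCluster (ends '' (↑ω : Set ι)) v)
    (huB : u ∉ openCluster (ends '' (↑(E \ ω) : Set ι)) b) (hvB : v ∉ openCluster (ends '' (↑(E \ ω) : Set ι)) b) :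
    openCluster (ends '' (↑(E \ ω) : Set ι)) b ⊆ (openCluster (ends '' (↑ω : Set ι)) u ∪ openCluster (ends '' (↑ω : Set ι)) v) ∪
      openCluster (ends '' (↑((E \ ω).filter (fun i => ∀ y, y ∈ ends i →
        y ∉ openCluster (ends '' (↑ω : Set ι)) u ∪ openCluster (ends '' (↑ω : Set ι)) v)) : Set ι)) b := by
  set P : Set V := openCluster (ends '' (↑ω : Set ι)) u ∪ openCluster (ends '' (↑ω : Set ι)) v with hPdef
  set Bl : Finset ι := E \ ω with hBl
  set Off : Finset ι := Bl.filter (fun i => ∀ y, y ∈ ends i → y ∉ P) with hOff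
  set Qout : Set V := openCluster (ends '' (↑Off : Set ι)) b with hQout
  have hOffBl : Off ⊆ Bl := Finset.filter_subset _ _
  have hQoutQ : Qout ⊆ openCluster (ends '' (↑Bl : Set ι)) b := openCluster_image_mono ends hOffBl b
  have hbP : b ∉ P := fun h => h.elim (fun h1 => hbu h1) (fun h1 => hbv h1)
  -- vertices of `Qout` lie outside `P`
  have hQoutP : ∀ x, x ∈ Qout → x ∉ P := by
    intro x hx hxP
    by_cases hxb : x = b
    · rw [hxb] at hxP; exact hbP hxP
    · obtain ⟨i, hi, hxi⟩ := exists_edge_of_mem_openCluster ends hx hxb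
      rw [hOff, Finset.mem_filter] at hi
      exact hi.2 x hxi hxP
  -- a vertex of `P` other than the roots carries a red edge
  have hPred : ∀ x, x ∈ P → x ≠ u → x ≠ v → ∃ r ∈ ω, x ∈ ends r := by
    intro x hx hxu hxv
    rcases hx with hx | hx
    · obtain ⟨r, hr, hxr⟩ := exists_edge_of_mem_openCluster ends hx hxu
      exact ⟨r, hr, hxr⟩
    · obtain ⟨r, hr, hxr⟩ := exists_edge_of_mem_openCluster ends hx hxv
      exact ⟨r, hr, hxr⟩
  -- the closed set `Qout ∪ D₁`
  set D₁ : Set V := {x | x ∈ P ∧ x ≠ u ∧ x ≠ v ∧ ∃ i ∈ Bl, ∃ q, ends i = s(x, q) ∧ q ∈ Qout} with hD₁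
  have key : openCluster (ends '' (↑Bl : Set ι)) b ⊆ Qout ∪ D₁ := by
    refine openCluster_subset_of_closed ends Bl b (S := Qout ∪ D₁) (Or.inl (mem_openCluster_self _ _)) ?_
    intro i hi x y he hx
    rcases hx with hx | hx
    · -- `x ∈ Qout`
      by_cases hyP : y ∈ P
      · right
        have hyQ : y ∈ openCluster (ends '' (↑Bl : Set ι)) b := mem_openCluster_of_edge ends hi he (hQoutQ hx)
        refine ⟨hyP, ?_, ?_, i, hi, x, by rw [he, Sym2.eq_swap], hx⟩
        · rintro rfl; exact huB hyQ
        · rintro rfl; exact hvB hyQ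
      · left
        have hiOff : i ∈ Off := by
          rw [hOff, Finset.mem_filter]
          refine ⟨hi, fun w hw hwP => ?_⟩
          rw [he, Sym2.mem_iff] at hw
          rcases hw with rfl | rfl
          · exact hQoutP _ hx hwP
          · exact hyP hwP
        exact mem_openCluster_of_edge ends hiOff he hx
    · -- `x ∈ D₁`: a red edge and a blue edge into `Qout` at `x`; degree ≤ 2 forces `i` to be that blue edge
      obtain ⟨hxP, hxu, hxv, i₀, hi₀, q, he₀, hq⟩ := hx
      have hxb : x ≠ b := by rintro rfl; exact hbP hxP
      obtain ⟨r, hr, hxr⟩ := hPred x hxP hxu hxv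
      have hri₀ : r ≠ i₀ := by rintro rfl; exact (Finset.mem_sdiff.mp hi₀).2 hr
      have hri : r ≠ i := by rintro rfl; exact (Finset.mem_sdiff.mp hi).2 hr
      have hx_i : x ∈ ends i := by rw [he]; exact Sym2.mem_mk_left x y
      have hx_i₀ : x ∈ ends i₀ := by rw [he₀]; exact Sym2.mem_mk_left x q
      rcases hdeg x hxu hxv hxb r i₀ i (hω hr) (Finset.mem_sdiff.mp hi₀).1 (Finset.mem_sdiff.mp hi).1 hxr hx_i₀ hx_i with h | h | h
      · exact absurd h hri₀
      · exact absurd h hri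
      · rw [h] at he₀
        have hqy : s(x, q) = s(x, y) := by rw [← he₀, he]
        rw [Sym2.eq_iff] at hqy
        rcases hqy with ⟨_, hqy⟩ | ⟨hxy, hqx⟩
        · left; rw [← hqy]; exact hq
        · right; rw [← hxy]; exact ⟨hxP, hxu, hxv, i, hi, q, by rw [he, ← hxy, hqx], hq⟩
  intro y hy
  rcases key hy with h | h
  · exact Or.inr h
  · exact Or.inl h.1

open Classical in
/-- **THEOREM DR-Θ — the double-root form for internal degree `≤ 2` (cycles through `u, b, v`, bundles).**  If no vertex other than `u, v, b` lies on
three distinct edges of `E`, then for all monotone `h, k` and monotone levels `0 ≤ hᵃ, hᵇ ≤ h`, `0 ≤ kᵃ, kᵇ ≤ k`: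
`0 ≤ Σ_{ω ⊆ E} h(S)k(S) + Σ_{ω : b ∉ C_u ω, b ∉ C_v ω} (hᵃ(C_u ω ∪ C_v ω) − hᵇ(C_b(E∖ω)))(kᵃ(C_u ω ∪ C_v ω) − kᵇ(C_b(E∖ω)))`,
`S = C_u ω ∪ C_v ω ∪ C_b ω`.  The map is the double-root `R_A`: flip every edge away from `P = C_u ω ∪ C_v ω` (an involution keeping `C_u, C_v`, turning
the blue cluster of `b` off `P` red; proper since `b ∉ C_u(ψω) ∪ C_v(ψω)`).  [cite: KozmaNitzan2024, Questions 8–9 (§5.5 p. 36) (context)] -/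
theorem coreClass_doubleRoot_of_deg_le_two (ends : ι → Sym2 V) (E : Finset ι) (u v b : V)
    (hdeg : ∀ x, x ≠ u → x ≠ v → x ≠ b → ∀ i j l, i ∈ E → j ∈ E → l ∈ E → x ∈ ends i → x ∈ ends j → x ∈ ends l → i = j ∨ i = l ∨ j = l)
    (h k ha hb ka kb : Set V → ℝ)
    (hh : Monotone h) (hk : Monotone k) (mha : Monotone ha) (mhb : Monotone hb) (mka : Monotone ka) (mkb : Monotone kb)
    (ha0 : ∀ X, 0 ≤ ha X) (hah : ∀ X, ha X ≤ h X) (hb0 : ∀ X, 0 ≤ hb X) (hbh : ∀ X, hb X ≤ h X)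
    (ka0 : ∀ X, 0 ≤ ka X) (kak : ∀ X, ka X ≤ k X) (kb0 : ∀ X, 0 ≤ kb X) (kbk : ∀ X, kb X ≤ k X) :
    0 ≤ (∑ ω ∈ E.powerset,
        h (openCluster (ends '' (↑ω : Set ι)) u ∪ openCluster (ends '' (↑ω : Set ι)) v ∪ openCluster (ends '' (↑ω : Set ι)) b) *
          k (openCluster (ends '' (↑ω : Set ι)) u ∪ openCluster (ends '' (↑ω : Set ι)) v ∪ openCluster (ends '' (↑ω : Set ι)) b))
      + ∑ ω ∈ E.powerset.filter (fun ω : Finset ι => b ∉ openCluster (ends '' (↑ω : Set ι)) u ∧ b ∉ openCluster (ends '' (↑ω : Set ι)) v),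
        (ha (openCluster (ends '' (↑ω : Set ι)) u ∪ openCluster (ends '' (↑ω : Set ι)) v) - hb (openCluster (ends '' (↑(E \ ω) : Set ι)) b)) *
          (ka (openCluster (ends '' (↑ω : Set ι)) u ∪ openCluster (ends '' (↑ω : Set ι)) v) - kb (openCluster (ends '' (↑(E \ ω) : Set ι)) b)) := by
  -- the double-root `R_A`
  set Foff : Finset ι → Finset ι := fun ω => E.filter (fun i => ∀ y, y ∈ ends i →
    y ∉ openCluster (ends '' (↑ω : Set ι)) u ∪ openCluster (ends '' (↑ω : Set ι)) v) with hFoff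
  have hFavoid : ∀ ω, ∀ i ∈ Foff ω, ∀ y, y ∈ ends i → y ∉ openCluster (ends '' (↑ω : Set ι)) u ∪ openCluster (ends '' (↑ω : Set ι)) v := by
    intro ω i hi y hy
    rw [hFoff, Finset.mem_filter] at hi
    exact hi.2 y hy
  have hCu : ∀ ω, openCluster (ends '' (↑(ω ∆ Foff ω) : Set ι)) u = openCluster (ends '' (↑ω : Set ι)) u :=
    fun ω => openCluster_symmDiff_off_eq ends ω (Foff ω) u _ Set.subset_union_left (hFavoid ω)
  have hCv : ∀ ω, openCluster (ends '' (↑(ω ∆ Foff ω) : Set ι)) v = openCluster (ends '' (↑ω : Set ι)) v :=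
    fun ω => openCluster_symmDiff_off_eq ends ω (Foff ω) v _ Set.subset_union_right (hFavoid ω)
  have hFcongr : ∀ ω ω' : Finset ι, openCluster (ends '' (↑ω' : Set ι)) u = openCluster (ends '' (↑ω : Set ι)) u →
      openCluster (ends '' (↑ω' : Set ι)) v = openCluster (ends '' (↑ω : Set ι)) v → Foff ω' = Foff ω := by
    intro ω ω' h1 h2
    simp only [hFoff, h1, h2]
  have hFfix : ∀ ω, Foff (ω ∆ Foff ω) = Foff ω := fun ω => hFcongr ω _ (hCu ω) (hCv ω)
  have hinv : ∀ ω, (ω ∆ Foff ω) ∆ Foff (ω ∆ Foff ω) = ω := by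
    intro ω
    rw [hFfix ω]
    ext i
    simp only [Finset.mem_symmDiff]
    tauto
  refine coreClass_doubleRoot_of_properDom ends E u v b h k ha hb ka kb hh hk mha mhb mka mkb ha0 hah hb0 hbh ka0 kak kb0 kbk
    (fun ω => ω ∆ Foff ω) ?_ ?_ ?_ ?_
  · -- stays inside `E`
    intro ω hω _ _ _ _ i hi
    rw [Finset.mem_symmDiff] at hi
    rcases hi with ⟨h1, _⟩ | ⟨h1, _⟩
    · exact hω h1
    · rw [hFoff, Finset.mem_filter] at h1; exact h1.1
  · -- coverage
    intro ω hω hbu hbv huB hvB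
    rw [hCu ω, hCv ω]
    intro y hy
    rcases hy with hy | hy
    · exact Or.inl hy
    · rcases doubleRoot_pocketFree_of_deg_le_two ends E u v b hdeg ω hω hbu hbv huB hvB hy with h1 | h1
      · exact Or.inl h1
      · refine Or.inr (openCluster_image_mono ends (fun i hi => ?_) b h1)
        rw [Finset.mem_filter, Finset.mem_sdiff] at hi
        rw [Finset.mem_symmDiff, hFoff, Finset.mem_filter]
        exact Or.inr ⟨⟨hi.1.1, hi.2⟩, hi.1.2⟩
  · -- injectivity (involution)
    intro ω₁ ω₂ _ _ _ _ _ _ _ _ _ _ he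
    have h1 := hinv ω₁
    have h2 := hinv ω₂
    beta_reduce at he
    rw [← h1, ← h2, he]
  · -- properness: `u, v ∉ C_b(ψ ω)` since `C_u(ψω) = C_u ω ∌ b`, `C_v(ψω) = C_v ω ∌ b`
    intro ω _ hbu hbv _ _
    refine ⟨fun hx => hbu ?_, fun hx => hbv ?_⟩
    · rw [← hCu ω]; exact (mem_openCluster_comm ends _ b u).mp hx
    · rw [← hCv ω]; exact (mem_openCluster_comm ends _ b v).mp hx

end Coefficientwise

end Summit.CriticalPhenomena.PercolationContinuityZ3.Theorems
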